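import Literature.AlgebraicTopology.SingularHomology.LocalHomologyMapsCoeff
import Literature.AlgebraicTopology.SingularHomology.LocalDegreeLinearization
import Literature.AlgebraicTopology.SingularHomology.TripleSequence
import HarnessLib

/-!
# A differentiable germ of `(ℝⁿ, 0)` with Jacobian of positive determinant acts on
# `Hₖ(ℝⁿ | 0; M)` like the identity, for all coefficients

G. E. Bredon, *Topology and Geometry* (1993), VI.7 (the local degree of a `C¹` map with invertible
Jacobian is that of its derivative); A. Hatcher, *Algebraic Topology* (2002), §2.2 Exercise 7 and
§3.3 p. 233 (invertible linear maps act on `Hₙ(ℝⁿ, ℝⁿ - 0)` by the sign of the determinant). The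
tree proves, with integer coefficients, the linearization `map_eq_map_affine_of_lineHomotopy_ne`
(`LocalDegreeLinearization`) and the sign statement; with arbitrary coefficients the positive case
is `localHomology_map_continuousLinearMap_of_det_pos_coeff` (`LocalHomologyMapsCoeff`). Here:

* `map_eq_map_affine_of_lineHomotopy_ne_coeff` — the linearization with coefficients `R`, `M`
  (same proof: the straight-line homotopy is a homotopy of maps of pairs,
  `relativeSingularHomology.map_eq_of_homotopic_holds`);
* **`exists_ball_map_eq_map_subtypeVal_of_det_pos`** — for `t : ℝⁿ → ℝⁿ` continuous on
  `B(0, ρ)` with `t 0 = 0`, `t v ≠ 0` for `0 ≠ v ∈ B(0, ρ)`, differentiable at `0` with derivative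
  `A`, `det A > 0`: there is `0 < r` with `B(0, r) ⊆ B(0, ρ)` such that the maps of pairs
  `(B(0, r), B(0, r) ∖ 0) → (ℝⁿ, ℝⁿ ∖ 0)` given by `t` and by the inclusion induce the SAME map on
  `Hₖ(·; M)` for every `k` and all coefficients.

This is the normal-direction computation behind the coherence of the local classes of a closed
submanifold straightened by charts with orientation-preserving transitions (Bredon VI.11).
Everything is proved; no definitions, no named facts.

## References

* [Bredon1993] G. E. Bredon, Topology and Geometry, GTM 139, Springer 1993, VI.7, VI.11.
* [HatcherAT2002] A. Hatcher, Algebraic Topology, CUP 2002, §2.2 Exercise 7, §3.3 p. 233.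
-/

noncomputable section

open CategoryTheory Limits Set Metric

universe v

namespace Literature.AlgebraicTopology.SingularHomology

variable (R : Type v) [CommRing R] (M : Type v) [AddCommGroup M] [Module R M]
variable {n : ℕ}

/-- **The straight-line homotopy to the affine approximation is a homotopy of maps of pairs**,
with coefficients `R`, `M`: on a ball `B = B(p, r)` on which the segment from `t v` to
`t p + A (v - p)` avoids `t p` for `v ≠ p`, the maps `t|_B` and `v ↦ t p + A (v - p)` induce the same
map `Hₖ(B | p; M) → Hₖ(ℝⁿ | t p; M)` (Bredon VI.7; the tree's
`map_eq_map_affine_of_lineHomotopy_ne` is the case `R = M = ℤ`). [cite: Bredon1993, VI.7] -/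
theorem map_eq_map_affine_of_lineHomotopy_ne_coeff
    {t : EuclideanSpace ℝ (Fin n) → EuclideanSpace ℝ (Fin n)} {p : EuclideanSpace ℝ (Fin n)}
    {A : EuclideanSpace ℝ (Fin n) →L[ℝ] EuclideanSpace ℝ (Fin n)} {r : ℝ} (hr : 0 < r)
    (htc : ContinuousOn t (ball p r))
    (hne : ∀ v ∈ ball p r, v ≠ p → ∀ s : ℝ, 0 ≤ s → s ≤ 1 →
      (1 - s) • t v + s • (t p + A (v - p)) ≠ t p)
    (h₀ : MapsTo (fun v : ↥(ball p r) => t v)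
      {(⟨p, mem_ball_self hr⟩ : ↥(ball p r))}ᶜ {t p}ᶜ)
    (h₁ : MapsTo (fun v : ↥(ball p r) => t p + A (v - p))
      {(⟨p, mem_ball_self hr⟩ : ↥(ball p r))}ᶜ {t p}ᶜ) (k : ℕ) :
    relativeSingularHomology.map R M
        (⟨fun v : ↥(ball p r) => t v, htc.restrict⟩ : C(↥(ball p r), EuclideanSpace ℝ (Fin n)))
        h₀ k =
      relativeSingularHomology.map R M
        (⟨fun v : ↥(ball p r) => t p + A (v - p), by fun_prop⟩ :
          C(↥(ball p r), EuclideanSpace ℝ (Fin n))) h₁ k := by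
  let F : ContinuousMap.Homotopy
      (⟨fun v : ↥(ball p r) => t v, htc.restrict⟩ : C(↥(ball p r), EuclideanSpace ℝ (Fin n)))
      (⟨fun v : ↥(ball p r) => t p + A (v - p), by fun_prop⟩ :
        C(↥(ball p r), EuclideanSpace ℝ (Fin n))) :=
    { toFun := fun q => (1 - (q.1 : ℝ)) • t q.2 + (q.1 : ℝ) • (t p + A (q.2 - p))
      continuous_toFun := by
        have hc : Continuous fun q : unitInterval × ↥(ball p r) => t q.2 :=
          htc.restrict.comp continuous_snd
        have hs : Continuous fun q : unitInterval × ↥(ball p r) => (q.1 : ℝ) :=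
          continuous_subtype_val.comp continuous_fst
        exact ((continuous_const.sub hs).smul hc).add
          (hs.smul (continuous_const.add (A.continuous.comp
            ((continuous_subtype_val.comp continuous_snd).sub continuous_const))))
      map_zero_left := fun v => by
        change (1 - ((0 : unitInterval) : ℝ)) • t v + ((0 : unitInterval) : ℝ) • (t p + A (v - p)) =
          t v
        rw [Set.Icc.coe_zero, sub_zero, one_smul, zero_smul, add_zero]
      map_one_left := fun v => by
        change (1 - ((1 : unitInterval) : ℝ)) • t v + ((1 : unitInterval) : ℝ) • (t p + A (v - p)) =
          t p + A (v - p)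
        rw [Set.Icc.coe_one, sub_self, zero_smul, one_smul, zero_add] }
  refine relativeSingularHomology.map_eq_of_homotopic_holds R M h₀ h₁ F (fun q hq => ?_) k
  have hvp : (q.2 : EuclideanSpace ℝ (Fin n)) ≠ p := fun h => hq (Subtype.ext h)
  exact hne q.2 q.2.2 hvp q.1 q.1.2.1 q.1.2.2

/-- A germ fixing `0` and non-vanishing off `0` on a ball is a map of pairs
`(B(0, r), B(0, r) ∖ 0) → (ℝⁿ, ℝⁿ ∖ 0)`. [folklore] -/
lemma mapsTo_of_ne_zero {t : EuclideanSpace ℝ (Fin n) → EuclideanSpace ℝ (Fin n)} {ρ r : ℝ}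
    (hsub : ball (0 : EuclideanSpace ℝ (Fin n)) r ⊆ ball 0 ρ) (hr : 0 < r)
    (hne0 : ∀ v ∈ ball (0 : EuclideanSpace ℝ (Fin n)) ρ, v ≠ 0 → t v ≠ 0) :
    MapsTo (fun v : ↥(ball (0 : EuclideanSpace ℝ (Fin n)) r) => t v)
      {(⟨0, mem_ball_self hr⟩ : ↥(ball (0 : EuclideanSpace ℝ (Fin n)) r))}ᶜ
      {(0 : EuclideanSpace ℝ (Fin n))}ᶜ :=
  fun v hv h0 ↦ hne0 v (hsub v.2) (fun h ↦ hv (Subtype.ext h)) h0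

/-- The inclusion of a ball about `0` is a map of pairs `(B(0, r), B(0, r) ∖ 0) → (ℝⁿ, ℝⁿ ∖ 0)`.
[folklore] -/
lemma mapsTo_subtypeVal_ball {r : ℝ} (hr : 0 < r) :
    MapsTo (Subtype.val : ↥(ball (0 : EuclideanSpace ℝ (Fin n)) r) → EuclideanSpace ℝ (Fin n))
      {(⟨0, mem_ball_self hr⟩ : ↥(ball (0 : EuclideanSpace ℝ (Fin n)) r))}ᶜ
      {(0 : EuclideanSpace ℝ (Fin n))}ᶜ :=
  fun _ hv h0 ↦ hv (Subtype.ext h0)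

/-- **A differentiable germ of `(ℝⁿ, 0)` with Jacobian of positive determinant acts on local
homology like the inclusion, for all coefficients** (Bredon VI.7 with Hatcher §2.2 Exercise 7):
let `t : ℝⁿ → ℝⁿ` be continuous on `B(0, ρ)`, `t 0 = 0`, `t v ≠ 0` for `0 ≠ v ∈ B(0, ρ)`, and
differentiable at `0` with derivative `A` of positive determinant. Then for some `0 < r` with
`B(0, r) ⊆ B(0, ρ)` the maps of pairs `(B(0, r), B(0, r) ∖ 0) → (ℝⁿ, ℝⁿ ∖ 0)` given by `t` and by
the inclusion induce the same map on `Hₖ(·; M)`, every `k`: `t ≃ A` through maps of pairs on a small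
ball (linearization), and `A_* = 𝟙` (`localHomology_map_continuousLinearMap_of_det_pos_coeff`).
[cite: Bredon1993, VI.7] [cite: HatcherAT2002, §2.2 Exercise 7] -/
theorem exists_ball_map_eq_map_subtypeVal_of_det_pos
    (t : EuclideanSpace ℝ (Fin n) → EuclideanSpace ℝ (Fin n)) {ρ : ℝ} (hρ : 0 < ρ)
    (htc : ContinuousOn t (ball 0 ρ)) (ht0 : t 0 = 0)
    {A : EuclideanSpace ℝ (Fin n) →L[ℝ] EuclideanSpace ℝ (Fin n)} (ht : HasFDerivAt t A 0)
    (hA : 0 < LinearMap.det (A : EuclideanSpace ℝ (Fin n) →ₗ[ℝ] EuclideanSpace ℝ (Fin n)))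
    (hne0 : ∀ v ∈ ball (0 : EuclideanSpace ℝ (Fin n)) ρ, v ≠ 0 → t v ≠ 0) :
    ∃ (r : ℝ) (hr : 0 < r) (hsub : ball (0 : EuclideanSpace ℝ (Fin n)) r ⊆ ball 0 ρ), ∀ k : ℕ,
      relativeSingularHomology.map R M
          (⟨fun v : ↥(ball (0 : EuclideanSpace ℝ (Fin n)) r) => t v, (htc.mono hsub).restrict⟩ :
            C(↥(ball (0 : EuclideanSpace ℝ (Fin n)) r), EuclideanSpace ℝ (Fin n)))
          (mapsTo_of_ne_zero hsub hr hne0) k =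
        relativeSingularHomology.map R M (subsetIncl (ball (0 : EuclideanSpace ℝ (Fin n)) r))
          (mapsTo_subtypeVal_ball hr) k := by
  obtain ⟨r, hr, hsub, hne⟩ := exists_ball_lineHomotopy_ne t ht hA.ne' (ball_mem_nhds 0 hρ)
  refine ⟨r, hr, hsub, fun k ↦ ?_⟩
  have hmA := mapsTo_continuousLinearMap_of_det_ne_zero hA.ne'
  -- maps of pairs into `(ℝⁿ, ℝⁿ ∖ t 0)` (before using `t 0 = 0` in types)
  have h₀' : MapsTo (fun v : ↥(ball (0 : EuclideanSpace ℝ (Fin n)) r) => t v)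
      {(⟨0, mem_ball_self hr⟩ : ↥(ball (0 : EuclideanSpace ℝ (Fin n)) r))}ᶜ {t 0}ᶜ := by
    intro _ hv h0
    exact mapsTo_of_ne_zero hsub hr hne0 hv (by rw [mem_singleton_iff] at h0; rw [h0, ht0]; rfl)
  have h₁' : MapsTo (fun v : ↥(ball (0 : EuclideanSpace ℝ (Fin n)) r) => t 0 + A (v - 0))
      {(⟨0, mem_ball_self hr⟩ : ↥(ball (0 : EuclideanSpace ℝ (Fin n)) r))}ᶜ {t 0}ᶜ := by
    intro _ hv h0
    rw [mem_singleton_iff, add_eq_left, sub_zero] at h0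
    exact hmA (mapsTo_subtypeVal_ball hr hv) h0
  have hid : MapsTo (ContinuousMap.id (EuclideanSpace ℝ (Fin n))) {t 0}ᶜ {(0 : EuclideanSpace ℝ (Fin n))}ᶜ := by
    intro _ hw
    rw [ht0] at hw
    exact hw
  -- linearization: `t ≃ (v ↦ t 0 + A (v - 0))` through maps of pairs
  have hlin := map_eq_map_affine_of_lineHomotopy_ne_coeff R M hr (htc.mono hsub) hne h₀' h₁' k
  have hlin' := congrArg (fun φ ↦ φ ≫ relativeSingularHomology.map R M
    (ContinuousMap.id (EuclideanSpace ℝ (Fin n))) hid k) hlin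
  simp only [← relativeSingularHomology.map_comp] at hlin'
  -- the left-hand side is `t` as a map of pairs into `(ℝⁿ, ℝⁿ ∖ 0)`
  have eL : relativeSingularHomology.map R M
      ((ContinuousMap.id (EuclideanSpace ℝ (Fin n))).comp
        (⟨fun v : ↥(ball (0 : EuclideanSpace ℝ (Fin n)) r) => t v, (htc.mono hsub).restrict⟩ :
          C(↥(ball (0 : EuclideanSpace ℝ (Fin n)) r), EuclideanSpace ℝ (Fin n))))
      (hid.comp h₀') k =
      relativeSingularHomology.map R M
        (⟨fun v : ↥(ball (0 : EuclideanSpace ℝ (Fin n)) r) => t v, (htc.mono hsub).restrict⟩ :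
          C(↥(ball (0 : EuclideanSpace ℝ (Fin n)) r), EuclideanSpace ℝ (Fin n)))
        (mapsTo_of_ne_zero hsub hr hne0) k :=
    relativeSingularHomology.map_congr R M (ContinuousMap.id_comp _) _ _ k
  -- the right-hand side is `A ∘ incl`, and `A_* = 𝟙`
  have haff : (ContinuousMap.id (EuclideanSpace ℝ (Fin n))).comp
      (⟨fun v : ↥(ball (0 : EuclideanSpace ℝ (Fin n)) r) => t 0 + A (v - 0), by fun_prop⟩ :
        C(↥(ball (0 : EuclideanSpace ℝ (Fin n)) r), EuclideanSpace ℝ (Fin n))) =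
      (A : C(EuclideanSpace ℝ (Fin n), EuclideanSpace ℝ (Fin n))).comp
        (subsetIncl (ball (0 : EuclideanSpace ℝ (Fin n)) r)) := by
    ext v : 1
    change t 0 + A (v - 0) = A v
    rw [ht0, zero_add, sub_zero]
  have eR : relativeSingularHomology.map R M
      ((ContinuousMap.id (EuclideanSpace ℝ (Fin n))).comp
        (⟨fun v : ↥(ball (0 : EuclideanSpace ℝ (Fin n)) r) => t 0 + A (v - 0), by fun_prop⟩ :
          C(↥(ball (0 : EuclideanSpace ℝ (Fin n)) r), EuclideanSpace ℝ (Fin n))))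
      (hid.comp h₁') k =
      relativeSingularHomology.map R M (subsetIncl (ball (0 : EuclideanSpace ℝ (Fin n)) r))
        (mapsTo_subtypeVal_ball hr) k := by
    rw [relativeSingularHomology.map_congr R M haff _ (hmA.comp (mapsTo_subtypeVal_ball hr)) k,
      relativeSingularHomology.map_comp R M _ _ (mapsTo_subtypeVal_ball hr) hmA]
    by_cases hk : k = n
    · subst hk
      rw [localHomology_map_continuousLinearMap_of_det_pos_coeff R M A hA]
      exact Category.comp_id _
    · exact (isZero_localHomology_of_ne (n := n) R M (0 : EuclideanSpace ℝ (Fin n)) hk).eq_of_tgt _ _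
  rw [← eL, hlin', eR]

end Literature.AlgebraicTopology.SingularHomology
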